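import Summits.CriticalPhenomena.PercolationContinuityZ3.Theorems.PercNearOneGluingNoHeavyLowerTailKNGoodTwoMarkFilter
import Summits.CriticalPhenomena.PercolationContinuityZ3.Theorems.PercNearOneGluingNoHeavyLowerTailKNGoodTwoMarkNoSinkPath
import Summits.CriticalPhenomena.PercolationContinuityZ3.Theorems.PercNearOneGluingNoHeavyLowerTailKNGoodTwoMarkDominance
import HarnessLib

/-!
# `NoHeavyLowerTail` (stmt-CriticalPhenomena-4575) — cluster domination at the Kozma–Nitzan box endpoint: the two
# unconditional cases (prim-hp-2 gen 28, MEMO-gen28 §5; part 5)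

Support file (`--supports stmt-CriticalPhenomena-4575`, hull-port prover `prim-hp-2`, gen 28).  No definitions, no
named facts, no sorries; standard axioms.

Part 4 (`…KNGoodTwoMarkDominance.lean`) reduced the box-endpoint domination
`μ_o(𝒰) ≥ κ_a ν_a(𝒰) + λ_t ν_t(𝒰)` (MEMO-gen26 §2; notation there) to the two-mark inequality (II) for `(t, c, o, a)` and
the up-family `E_t = {C_t ∈ 𝒰}`.  Plugging in the two cases of (II) that are tree theorems:

* `KNGoodTwoMark.dominance_endpoint_filter` — for every up-family `𝒰` all of whose members contain `a`
  (from `filter_tilt`, gen 26), assuming `μ(t, a, c pairwise separated) ≠ 0`;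
* `KNGoodTwoMark.dominance_endpoint_of_no_sinkpath` — for EVERY up-family when `μ(a~c, t↮c) = 0`
  (from `cov_tilt_of_no_sinkpath`, gen 28), assuming `μ({t↮a}∩{t↮c}) ≠ 0`.
The constant is lowered from `κ_M` (resp. `κ̃`) to the box constant `κ_a` with `tilt_weaken` and Kozma–Nitzan's
Lemma 1(i) (`lemma1_step`).
[cite: VandenbergHaggstromKahn2005, Thms. 1.1–1.5 (pp. 3–8)] [cite: KozmaNitzan2024, §2.2 Lemmas 1–2 (pp. 5–6), §3 (pp. 7–12)]
-/

noncomputable section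

namespace Summit.CriticalPhenomena.PercolationContinuityZ3.Theorems

open MeasureTheory Set Literature.Probability.LatticeModels Literature.Probability.Percolation
open scoped Classical

namespace KNGoodTwoMark

variable {V : Type*} [Fintype V]

omit [Fintype V] in
/-- `M = {t↮a} ∩ {t↮c} ∩ {a↮c}` written from `a`'s side. [folklore] -/
theorem sepM_eq (c a t : V) :
    {ω : BondConfig V | (¬ (openGraph ω).Reachable t a ∧ ¬ (openGraph ω).Reachable t c) ∧ ¬ (openGraph ω).Reachable a c} =
      {ω : BondConfig V | ¬ (openGraph ω).Reachable a t ∧ ¬ (openGraph ω).Reachable a c} ∩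
        {ω | ¬ (openGraph ω).Reachable t c} := by
  ext ω
  simp only [Set.mem_setOf_eq, Set.mem_inter_iff]
  constructor
  · rintro ⟨⟨hta, htc⟩, hac⟩; exact ⟨⟨fun h => hta h.symm, hac⟩, htc⟩
  · rintro ⟨⟨hat, hac⟩, htc⟩; exact ⟨⟨fun h => hat h.symm, htc⟩, hac⟩

/-- **Domination at the box endpoint, UNCONDITIONALLY for up-families inside `{a ∈ W}`** (from `filter_tilt` = (II) on the
principal filter, gen 26): with the notation of `dominance_endpoint_of_tilt`, if every member of `𝒰` contains `a` and
`μ(M) ≠ 0` (`M = {t,a,c pairwise separated}`), then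
`μ_o(𝒰)·μ(D)·μ(R) ≥ μ(D∩{a~o})·μ(R)·ν_a(𝒰) + [μ(R∩{t~o})μ(D) − μ(D∩{a~o})μ(R∩{t~a})]·ν_t(𝒰)`.
[cite: KozmaNitzan2024, §2.2 Lemmas 1–2 (pp. 5–6)] [cite: VandenbergHaggstromKahn2005, Thms. 1.2–1.3 (pp. 5–6)] -/
theorem dominance_endpoint_filter (w : Sym2 V → unitInterval) (o c a t : V) (𝒰 : Set (Set V))
    (hU : ∀ W ∈ 𝒰, ∀ W' : Set V, W ⊆ W' → W' ∈ 𝒰) (haU : ∀ W ∈ 𝒰, a ∈ W)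
    (hM : (prodBernoulli w).real {ω : BondConfig V | (¬ (openGraph ω).Reachable t a ∧ ¬ (openGraph ω).Reachable t c) ∧
        ¬ (openGraph ω).Reachable a c} ≠ 0) :
    (prodBernoulli w).real ({ω : BondConfig V | ¬ (openGraph ω).Reachable a t ∧ ¬ (openGraph ω).Reachable a c} ∩
          {ω | (openGraph ω).Reachable a o}) *
        (prodBernoulli w).real {ω : BondConfig V | ¬ (openGraph ω).Reachable t c} *
        (prodBernoulli w).real ({ω : BondConfig V | {v | (openGraph ω).Reachable a v} ∈ 𝒰} ∩
          {ω | ¬ (openGraph ω).Reachable a c}) +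
      ((prodBernoulli w).real ({ω : BondConfig V | ¬ (openGraph ω).Reachable t c} ∩ {ω | (openGraph ω).Reachable t o}) *
          (prodBernoulli w).real {ω : BondConfig V | ¬ (openGraph ω).Reachable a t ∧ ¬ (openGraph ω).Reachable a c} -
        (prodBernoulli w).real ({ω : BondConfig V | ¬ (openGraph ω).Reachable a t ∧ ¬ (openGraph ω).Reachable a c} ∩
            {ω | (openGraph ω).Reachable a o}) *
          (prodBernoulli w).real ({ω : BondConfig V | ¬ (openGraph ω).Reachable t c} ∩ {ω | (openGraph ω).Reachable t a})) *
        (prodBernoulli w).real ({ω : BondConfig V | ¬ (openGraph ω).Reachable t c} ∩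
          {ω | {v | (openGraph ω).Reachable t v} ∈ 𝒰}) ≤
    (prodBernoulli w).real ({ω : BondConfig V | {v | (openGraph ω).Reachable o v} ∈ 𝒰} ∩
          ({ω | (openGraph ω).Reachable o a ∨ (openGraph ω).Reachable o t} ∩ {ω | ¬ (openGraph ω).Reachable o c})) *
        (prodBernoulli w).real {ω : BondConfig V | ¬ (openGraph ω).Reachable a t ∧ ¬ (openGraph ω).Reachable a c} *
        (prodBernoulli w).real {ω : BondConfig V | ¬ (openGraph ω).Reachable t c} := by
  have hft := filter_tilt w o a t c 𝒰 hU haU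
  have hl1 := lemma1_step w o t a c
  set μ := prodBernoulli w with hμ
  set R : Set (BondConfig V) := {ω | ¬ (openGraph ω).Reachable t c} with hR
  set D : Set (BondConfig V) := {ω | ¬ (openGraph ω).Reachable a t ∧ ¬ (openGraph ω).Reachable a c} with hD
  set K : Set (BondConfig V) := {ω | ¬ (openGraph ω).Reachable t a ∧ ¬ (openGraph ω).Reachable t c} with hK
  set M : Set (BondConfig V) := {ω | (¬ (openGraph ω).Reachable t a ∧ ¬ (openGraph ω).Reachable t c) ∧
      ¬ (openGraph ω).Reachable a c} with hMdef
  set O : Set (BondConfig V) := {ω | (openGraph ω).Reachable t o} with hO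
  set A : Set (BondConfig V) := {ω | (openGraph ω).Reachable t a} with hA
  set Et : Set (BondConfig V) := {ω | {v | (openGraph ω).Reachable t v} ∈ 𝒰} with hEt
  set Oa : Set (BondConfig V) := {ω | (openGraph ω).Reachable a o} with hOa
  -- `E_t ⊆ A`, `R = (R ∩ A) ⊔ K`
  have hEA : R ∩ (A ∩ Et) = R ∩ Et := by
    ext ω
    simp only [Set.mem_inter_iff, and_congr_right_iff, and_iff_right_iff_imp]
    intro _ hE
    exact haU _ hE
  have hRK : μ.real R = μ.real (R ∩ A) + μ.real K := by
    have hd : Disjoint (R ∩ A) K := by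
      rw [Set.disjoint_left]; rintro ω ⟨-, hta⟩ ⟨hta', -⟩; exact hta' hta
    have hu : R = (R ∩ A) ∪ K := by
      ext ω; constructor
      · intro hR'
        by_cases h : (openGraph ω).Reachable t a
        · exact Or.inl ⟨hR', h⟩
        · exact Or.inr ⟨h, hR'⟩
      · rintro (⟨hR', -⟩ | ⟨-, hR'⟩) <;> exact hR'
    rw [← measureReal_union hd MeasurableSet.of_discrete, ← hu]
  -- `M = D ∩ R`, and the Lemma-1 comparison `μ(D∩Oa)·μ(M) ≤ μ(M∩Oa)·μ(D)`
  have hMD : M = D ∩ R := by rw [hMdef, hD, hR]; exact sepM_eq c a t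
  have hcmp : μ.real (D ∩ Oa) * μ.real M ≤ μ.real (M ∩ Oa) * μ.real D := by
    have h1 : (D ∩ R) ∩ Oa = D ∩ (Oa ∩ R) := by ext ω; simp only [Set.mem_inter_iff]; tauto
    rw [hMD, h1]
    linarith [hl1]
  -- (II) with constant κ_M, in the general shape
  have h2M : μ.real (R ∩ O) * μ.real (R ∩ Et) * μ.real M + μ.real (M ∩ Oa) * μ.real (R ∩ (A ∩ Et)) * μ.real R ≤
      μ.real (R ∩ (O ∩ Et)) * μ.real R * μ.real M + μ.real (M ∩ Oa) * μ.real (R ∩ A) * μ.real (R ∩ Et) := by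
    rw [hEA]
    have e1 : μ.real (M ∩ Oa) * μ.real (R ∩ Et) * μ.real R =
        μ.real (M ∩ Oa) * μ.real (R ∩ Et) * μ.real (R ∩ A) + μ.real K * μ.real (M ∩ Oa) * μ.real (R ∩ Et) := by
      rw [hRK]; ring
    linarith [hft, e1]
  have hMpos : 0 < μ.real M := lt_of_le_of_ne measureReal_nonneg (Ne.symm hM)
  have h2 := tilt_weaken w o c a t 𝒰 hU hMpos (measureReal_nonneg : 0 ≤ μ.real D) hcmp h2M
  exact dominance_endpoint_of_tilt w o c a t 𝒰 hU h2

/-- **Domination at the box endpoint, UNCONDITIONALLY for ALL up-families when `a` cannot reach `c` off `t`**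
(`μ(a~c, t↮c) = 0`; from `cov_tilt_of_no_sinkpath` with the sink set `{c}`), given `μ({t↮a}∩{t↮c}) ≠ 0`.
[cite: KozmaNitzan2024, §2.2 Lemmas 1–2 (pp. 5–6)] [cite: VandenbergHaggstromKahn2005, Thms. 1.2–1.3 (pp. 5–6)] -/
theorem dominance_endpoint_of_no_sinkpath (w : Sym2 V → unitInterval) (o c a t : V) (𝒰 : Set (Set V))
    (hU : ∀ W ∈ 𝒰, ∀ W' : Set V, W ⊆ W' → W' ∈ 𝒰)
    (hax : (prodBernoulli w).real {ω : BondConfig V | (openGraph ω).Reachable a c ∧ ¬ (openGraph ω).Reachable t c} = 0)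
    (hK : (prodBernoulli w).real {ω : BondConfig V | ¬ (openGraph ω).Reachable t a ∧ ¬ (openGraph ω).Reachable t c} ≠ 0) :
    (prodBernoulli w).real ({ω : BondConfig V | ¬ (openGraph ω).Reachable a t ∧ ¬ (openGraph ω).Reachable a c} ∩
          {ω | (openGraph ω).Reachable a o}) *
        (prodBernoulli w).real {ω : BondConfig V | ¬ (openGraph ω).Reachable t c} *
        (prodBernoulli w).real ({ω : BondConfig V | {v | (openGraph ω).Reachable a v} ∈ 𝒰} ∩
          {ω | ¬ (openGraph ω).Reachable a c}) +
      ((prodBernoulli w).real ({ω : BondConfig V | ¬ (openGraph ω).Reachable t c} ∩ {ω | (openGraph ω).Reachable t o}) *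
          (prodBernoulli w).real {ω : BondConfig V | ¬ (openGraph ω).Reachable a t ∧ ¬ (openGraph ω).Reachable a c} -
        (prodBernoulli w).real ({ω : BondConfig V | ¬ (openGraph ω).Reachable a t ∧ ¬ (openGraph ω).Reachable a c} ∩
            {ω | (openGraph ω).Reachable a o}) *
          (prodBernoulli w).real ({ω : BondConfig V | ¬ (openGraph ω).Reachable t c} ∩ {ω | (openGraph ω).Reachable t a})) *
        (prodBernoulli w).real ({ω : BondConfig V | ¬ (openGraph ω).Reachable t c} ∩
          {ω | {v | (openGraph ω).Reachable t v} ∈ 𝒰}) ≤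
    (prodBernoulli w).real ({ω : BondConfig V | {v | (openGraph ω).Reachable o v} ∈ 𝒰} ∩
          ({ω | (openGraph ω).Reachable o a ∨ (openGraph ω).Reachable o t} ∩ {ω | ¬ (openGraph ω).Reachable o c})) *
        (prodBernoulli w).real {ω : BondConfig V | ¬ (openGraph ω).Reachable a t ∧ ¬ (openGraph ω).Reachable a c} *
        (prodBernoulli w).real {ω : BondConfig V | ¬ (openGraph ω).Reachable t c} := by
  have hax' : (prodBernoulli w).real {ω : BondConfig V | (∃ t' ∈ ({c} : Set V), (openGraph ω).Reachable a t') ∧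
      ∀ t' ∈ ({c} : Set V), ¬ (openGraph ω).Reachable t t'} = 0 := by
    have : {ω : BondConfig V | (∃ t' ∈ ({c} : Set V), (openGraph ω).Reachable a t') ∧
        ∀ t' ∈ ({c} : Set V), ¬ (openGraph ω).Reachable t t'} =
        {ω : BondConfig V | (openGraph ω).Reachable a c ∧ ¬ (openGraph ω).Reachable t c} := by
      ext ω; simp
    rw [this]; exact hax
  have hct := cov_tilt_of_no_sinkpath w o a t ({c} : Set V) 𝒰 hU hax'
  have hl1 := lemma1_step w o t a c
  have hR' : {ω : BondConfig V | ∀ t' ∈ ({c} : Set V), ¬ (openGraph ω).Reachable t t'} =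
      {ω | ¬ (openGraph ω).Reachable t c} := by ext ω; simp
  have hK' : {ω : BondConfig V | ¬ (openGraph ω).Reachable t a ∧ ∀ t' ∈ ({c} : Set V), ¬ (openGraph ω).Reachable t t'} =
      {ω | ¬ (openGraph ω).Reachable t a ∧ ¬ (openGraph ω).Reachable t c} := by ext ω; simp
  rw [hR', hK'] at hct
  set μ := prodBernoulli w with hμ
  set R : Set (BondConfig V) := {ω | ¬ (openGraph ω).Reachable t c} with hR
  set D : Set (BondConfig V) := {ω | ¬ (openGraph ω).Reachable a t ∧ ¬ (openGraph ω).Reachable a c} with hD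
  set K : Set (BondConfig V) := {ω | ¬ (openGraph ω).Reachable t a ∧ ¬ (openGraph ω).Reachable t c} with hKdef
  set O : Set (BondConfig V) := {ω | (openGraph ω).Reachable t o} with hO
  set A : Set (BondConfig V) := {ω | (openGraph ω).Reachable t a} with hA
  set Et : Set (BondConfig V) := {ω | {v | (openGraph ω).Reachable t v} ∈ 𝒰} with hEt
  set Oa : Set (BondConfig V) := {ω | (openGraph ω).Reachable a o} with hOa
  set X : Set (BondConfig V) := {ω | (openGraph ω).Reachable a c ∧ ¬ (openGraph ω).Reachable t c} with hX
  -- under `hax`, `K` and `M = D ∩ R` agree in measure (also after intersecting with `Oa`)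
  have hMK : D ∩ R ⊆ K := by
    rintro ω ⟨⟨hat, -⟩, htc⟩; exact ⟨fun h => hat h.symm, htc⟩
  have hKM : ∀ Y : Set (BondConfig V), K ∩ Y ⊆ (D ∩ R) ∩ Y ∪ X := by
    intro Y ω ⟨⟨hta, htc⟩, hy⟩
    by_cases hac : (openGraph ω).Reachable a c
    · exact Or.inr ⟨hac, htc⟩
    · exact Or.inl ⟨⟨⟨fun h => hta h.symm, hac⟩, htc⟩, hy⟩
  have hKY : ∀ Y : Set (BondConfig V), μ.real (K ∩ Y) = μ.real ((D ∩ R) ∩ Y) := by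
    intro Y
    apply le_antisymm
    · calc μ.real (K ∩ Y) ≤ μ.real ((D ∩ R) ∩ Y ∪ X) := measureReal_mono (hKM Y)
        _ ≤ μ.real ((D ∩ R) ∩ Y) + μ.real X := measureReal_union_le _ _
        _ = μ.real ((D ∩ R) ∩ Y) := by rw [hax, add_zero]
    · exact measureReal_mono (Set.inter_subset_inter_left Y hMK)
  have hKuniv : μ.real K = μ.real (D ∩ R) := by simpa only [Set.inter_univ] using hKY Set.univ
  have hcmp : μ.real (D ∩ Oa) * μ.real K ≤ μ.real (K ∩ Oa) * μ.real D := by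
    rw [hKuniv, hKY Oa]
    have h1 : (D ∩ R) ∩ Oa = D ∩ (Oa ∩ R) := by ext ω; simp only [Set.mem_inter_iff]; tauto
    rw [h1]
    linarith [hl1]
  have hKpos : 0 < μ.real K := lt_of_le_of_ne measureReal_nonneg (Ne.symm hK)
  have h2 := tilt_weaken w o c a t 𝒰 hU hKpos (measureReal_nonneg : 0 ≤ μ.real D) hcmp hct
  exact dominance_endpoint_of_tilt w o c a t 𝒰 hU h2

end KNGoodTwoMark

end Summit.CriticalPhenomena.PercolationContinuityZ3.Theorems
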